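import Literature.Analysis.FluidPDE.OseenHeatKernelBridge
import Literature.Analysis.FluidPDE.KNSSTypeIRateVertexProofs
import Literature.Analysis.FluidPDE.SereginSverakBlowupSelection
import Literature.Analysis.FluidPDE.NSBoundedMildOseenClassical
import HarnessLib

/-!
# KNSS 2009, Theorem 6.1, mildness clause — I: horizontal decay of the caloric and Duhamel
# terms, the drift bridge, continuity in the initial time

Analysis/FluidPDE support file (everything proved; no definitions, no named facts) on the
discharge path of the named fact `Literature.Analysis.FluidPDE.KNSS2009_mild_of_rMulNorm_bounded`
(`KNSSMildDecay.lean`; Koch–Nadirashvili–Seregin–Šverák, Acta Math. 203 (2009) =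
arXiv:0709.3599, proof of Theorem 6.1, last paragraph, p. 12):

> "we inspect the decomposition of `u` constructed in Lemma 3.1 with `f_k = -u_k u`. Using the
> decay of the kernel (3.8) and of the heat kernel, it is easy to check that, under the assumption
> (6.2) [`|u(x,t)| ≤ C/|x'|`], all the terms in the decomposition `u = v + w + b` will again
> satisfy (6.2). It follows easily that `b` must vanish and therefore `u` is a mild solution."

Lemma 3.1 is proved in the tree in drift-mild form (`KNSS2009_weak_driftMild_holds`,
`KNSSWeakDriftMildProofs.lean`: `u = U + b(t)` a.e. with
`U(t) = e^{(t-s)Δ}U(s) - driftDuhamel U b s t`), in the heat-flow realisation `oseenHeat` of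
`e^{τΔ}P∇·`, and the two realisations of the tree are identified on rank-one tensors
(`sum_oseenHeat_smul_eq_oseenSlice`, `OseenHeatKernelBridge.lean`). This file supplies the
analytic lemmas of the quoted paragraph, in the qualitative form that the argument uses:

* `driftDuhamel_eq_oseenDuhamel_drift` — **the drift bridge**: for any drift `b`,
  `driftDuhamel U b s t x = B¹_s(U + b, U + b)(t)(x)` (`oseenDuhamel` of the full velocity
  `u = U + b`; the zero-drift case is `driftDuhamel_zero_eq_oseenDuhamel` of the bridge file);
* `exists_forall_norm_heatExtension_le_of_cylRadius` — **the caloric extension of bounded data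
  decaying at horizontal infinity decays at horizontal infinity** ("the decay … of the heat
  kernel"): `sup_{|x'| ≥ R} ‖e^{τΔ}g(x)‖ → 0` as `R → ∞` (Gaussian tail + the decay of `g` on the
  bulk of the kernel, `|x'|` being `1`-Lipschitz);
* `exists_forall_norm_oseenDuhamel_le_of_cylRadius` — **the Duhamel term of bounded fields
  decaying at horizontal infinity, uniformly in time, decays at horizontal infinity** ("the decay
  of the kernel (3.8)"): split the fields along `{|y'| ≥ R₀} ⊔ {|y'| < R₀}`
  (`oseenDuhamel_eq_add_of_indicator_compl`); the far fields are uniformly small, so their Duhamel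
  term is small by the `L^∞` bound (4.4) (`exists_norm_oseenDuhamel_bounded_le`); the near fields
  live at distance `≥ R₁` from a point `x` with `|x'| ≥ R₀ + R₁`, where the kernel is bounded by
  the tail of the integrable envelope `4(1 + ‖z‖²)^{-2}` ((3.8) in dimension three);
* `continuousAt_heatExtension_datum`, `continuousAt_oseenDuhamel_initialTime` — continuity in the
  **initial time** `r` of `e^{(t-r)Δ}u(r)(x)` (dominated convergence under a fixed Gaussian) and of
  `B¹_r(u,u)(t)(x)` (a primitive of an integrable function), for a field `u` continuous and bounded
  on an open slab — used to pass the representation formula from almost every initial time to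
  every initial time.

## Mathlib / tree search

Tree: `sum_oseenHeat_smul_eq_oseenSlice`, `oseenSlice_apply` (`OseenHeatKernelBridge`,
`OseenSlice`); `driftDuhamel_apply`, `driftTensor_apply` (`KNSSRegularityDecomposition`);
`oseenDuhamel_eq_add_of_indicator_compl` (`KNSSTypeIRateVertexProofs`);
`exists_norm_oseenDuhamel_bounded_le`, `integrable_oseenKernel_duhamel_bounded`
(`NSBoundedMildOseenDuhamel`); `exists_norm_oseenKernel_le`, `integrable_one_add_norm_sq_rpow_neg`,
`continuousOn_heatKernel_time` (`KochTataruKernel`); `integrable_heatKernel_smul_of_norm_le`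
(`KNSSRegularityGalileanProofs`); `heatKernel_le_mul_heatKernel_of_norm_sub_le`
(`NSBoundedMildOseenClassical`); `SereginSverak2009.cylRadius_le_cylRadius_add`,
`SereginSverak2009.cylRadius_le_norm'` (`SereginSverakBlowupSelection`). Mathlib:
`tendsto_setIntegral_of_antitone`, `continuousAt_of_dominated`,
`intervalIntegral.continuousOn_primitive_interval'`, `lintegral_sub_left_eq_self`,
`ofReal_integral_eq_lintegral_ofReal`, `Real.rpow_le_rpow_of_nonpos`.

## References

* G. Koch, N. Nadirashvili, G. Seregin, V. Šverák, *Liouville theorems for the Navier–Stokes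
  equations and applications*, Acta Math. 203 (2009) 83–105 = arXiv:0709.3599: proof of Thm 6.1,
  last paragraph (p. 12); §3 (3.3), (3.8) (p. 6); §4 (4.3)–(4.4) (p. 8).
  [KochNadirashviliSereginSverak2009]
-/

noncomputable section

open MeasureTheory Set Function Filter TopologicalSpace InnerProductSpace Metric
open _root_.Topology
open scoped ENNReal NNReal RealInnerProductSpace

namespace Literature.Analysis.FluidPDE

/-! ### The drift bridge -/

section DriftBridge

/-- **The drift bridge**: for slices `U(σ) + b(σ)`, `σ ∈ (s, t)`, measurable and bounded by `N`,
`driftDuhamel U b s t x = B¹_s(U + b, U + b)(t)(x)` — the Duhamel term of the drift-mild identity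
(`oseenHeat` realisation, tensor `(U + b) ⊗ (U + b)`, `driftTensor`) is the tree's `oseenDuhamel`
of the full velocity `u = U + b` (KNSS 2009, (4.3) with `u = U + b`; the two realisations agree
on rank-one tensors, `sum_oseenHeat_smul_eq_oseenSlice`). [cite: KochNadirashviliSereginSverak2009, §4 (4.3) (arXiv:0709.3599 p. 8)] -/
theorem driftDuhamel_eq_oseenDuhamel_drift
    {U : ℝ → EuclideanSpace ℝ (Fin 3) → EuclideanSpace ℝ (Fin 3)} {b : ℝ → EuclideanSpace ℝ (Fin 3)}
    {s t N : ℝ} (hUm : ∀ σ ∈ Ioo s t, Measurable (U σ))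
    (hN : ∀ σ ∈ Ioo s t, ∀ y, ‖U σ y + b σ‖ ≤ N) (hst : s ≤ t) (x : EuclideanSpace ℝ (Fin 3)) :
    driftDuhamel U b s t x =
      oseenDuhamel 1 s (fun σ y => U σ y + b σ) (fun σ y => U σ y + b σ) t x := by
  have hE : Module.finrank ℝ (EuclideanSpace ℝ (Fin 3)) = 3 := finrank_euclideanSpace_fin
  rw [driftDuhamel_apply, oseenDuhamel_apply, intervalIntegral.integral_of_le hst,
    integral_Ioc_eq_integral_Ioo]
  refine setIntegral_congr_fun measurableSet_Ioo fun σ hσ => ?_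
  have hF : ∀ j k y, driftTensor U b σ j k y =
      ⟪U σ y + b σ, stdOrthonormalBasis ℝ (EuclideanSpace ℝ (Fin 3)) j⟫ *
        ⟪U σ y + b σ, stdOrthonormalBasis ℝ (EuclideanSpace ℝ (Fin 3)) k⟫ := fun j k y => rfl
  have hm : Measurable fun y => U σ y + b σ := (hUm σ hσ).add_const _
  rw [sum_oseenHeat_smul_eq_oseenSlice hE hm hm (hN σ hσ) (hN σ hσ) hF (sub_pos.2 hσ.2) x,
    oseenSlice_apply, one_mul]

end DriftBridge

/-! ### Horizontal decay of the caloric extension -/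

section HeatDecay

/-- **Tails of an integrable function over the exterior of large balls vanish**:
`∫_{R ≤ ‖z‖} f → 0` as `R → ∞` (`tendsto_setIntegral_of_antitone`, `⋂_R {R ≤ ‖z‖} = ∅`).
[folklore] -/
theorem tendsto_setIntegral_norm_ge_atTop {F : Type*} [NormedAddCommGroup F]
    [MeasurableSpace F] [OpensMeasurableSpace F] {μ : Measure F} {f : F → ℝ}
    (hf : Integrable f μ) :
    Tendsto (fun R : ℝ => ∫ z in {z : F | R ≤ ‖z‖}, f z ∂μ) atTop (𝓝 0) := by
  have hsm : ∀ R : ℝ, MeasurableSet {z : F | R ≤ ‖z‖} := fun R =>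
    (isClosed_le continuous_const continuous_norm).measurableSet
  have hanti : Antitone fun R : ℝ => {z : F | R ≤ ‖z‖} := fun R R' h z hz => le_trans h hz
  have h := tendsto_setIntegral_of_antitone (μ := μ) hsm hanti ⟨0, hf.integrableOn⟩
  have hempty : (⋂ R : ℝ, {z : F | R ≤ ‖z‖}) = ∅ := by
    ext z
    simp only [mem_iInter, mem_setOf_eq, mem_empty_iff_false, iff_false, not_forall, not_le]
    exact ⟨‖z‖ + 1, by linarith⟩
  rw [hempty, Measure.restrict_empty, integral_zero_measure] at h
  exact h

/-- **The caloric extension of bounded data decaying at horizontal infinity decays at horizontal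
infinity** (KNSS 2009, proof of Thm 6.1, last paragraph: "the decay … of the heat kernel"). If
`g` is measurable with `‖g‖ ≤ C` and `sup_{|z'| ≥ R} ‖g(z)‖ → 0` as `R → ∞`
(`|z'| = cylRadius z`), then for every `τ > 0` and `ε > 0` there is `R` with `‖e^{τΔ}g(x)‖ ≤ ε`
whenever `|x'| ≥ R`: the Gaussian mass outside `B(0, R₁)` is small, and on `B(0, R₁)` the data
`g(x - y)` is small since `|(x - y)'| ≥ |x'| - ‖y‖`. [cite: KochNadirashviliSereginSverak2009, proof of Thm 6.1, last paragraph (arXiv p. 12)] -/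
theorem exists_forall_norm_heatExtension_le_of_cylRadius
    {g : EuclideanSpace ℝ (Fin 3) → EuclideanSpace ℝ (Fin 3)} (hgm : AEStronglyMeasurable g volume)
    {C : ℝ} (hC : ∀ z, ‖g z‖ ≤ C)
    (hdec : ∀ ε > 0, ∃ R : ℝ, ∀ z, R ≤ cylRadius z → ‖g z‖ ≤ ε) {τ : ℝ} (hτ : 0 < τ) {ε : ℝ}
    (hε : 0 < ε) :
    ∃ R : ℝ, ∀ x, R ≤ cylRadius x → ‖UnboundedOperators.heatExtension g τ x‖ ≤ ε := by
  have hC0 : 0 ≤ C := (norm_nonneg _).trans (hC 0)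
  set G : EuclideanSpace ℝ (Fin 3) → ℝ := UnboundedOperators.heatKernel τ with hG
  have hGi : Integrable G volume := UnboundedOperators.integrable_heatKernel_holds hτ
  have hG0 : ∀ y, 0 ≤ G y := fun y => (UnboundedOperators.heatKernel_pos hτ y).le
  -- the Gaussian tail
  have htail := tendsto_setIntegral_norm_ge_atTop hGi
  set η : ℝ := ε / 2 / (C + 1) with hη
  have hη0 : 0 < η := by positivity
  obtain ⟨R₁, hR₁⟩ := (htail.eventually (gt_mem_nhds hη0)).exists_forall_of_atTop
  -- the decay of the data
  obtain ⟨R₀, hR₀⟩ := hdec (ε / 2) (by positivity)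
  refine ⟨R₀ + R₁, fun x hx => ?_⟩
  have hsm : MeasurableSet {y : EuclideanSpace ℝ (Fin 3) | R₁ ≤ ‖y‖} :=
    (isClosed_le continuous_const continuous_norm).measurableSet
  -- pointwise majorant of the convolution integrand
  have hpt : ∀ y, ‖G y • g (x - y)‖ ≤
      G y * (ε / 2) + C * ({y : EuclideanSpace ℝ (Fin 3) | R₁ ≤ ‖y‖}.indicator G y) := by
    intro y
    rw [norm_smul, Real.norm_of_nonneg (hG0 y)]
    by_cases hy : R₁ ≤ ‖y‖
    · rw [indicator_of_mem (show y ∈ {y : EuclideanSpace ℝ (Fin 3) | R₁ ≤ ‖y‖} from hy)]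
      have h1 : G y * ‖g (x - y)‖ ≤ G y * C := mul_le_mul_of_nonneg_left (hC _) (hG0 y)
      have h2 : 0 ≤ G y * (ε / 2) := mul_nonneg (hG0 y) (by positivity)
      nlinarith
    · rw [indicator_of_notMem (show y ∉ {y : EuclideanSpace ℝ (Fin 3) | R₁ ≤ ‖y‖} from hy),
        mul_zero, add_zero]
      refine mul_le_mul_of_nonneg_left (hR₀ _ ?_) (hG0 y)
      have h1 := SereginSverak2009.cylRadius_le_cylRadius_add x y
      have h2 := SereginSverak2009.cylRadius_le_norm' y
      linarith [not_le.1 hy]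
  have hint1 : Integrable (fun y => G y * (ε / 2)) volume := hGi.mul_const _
  have hint2 : Integrable
      (fun y => C * ({y : EuclideanSpace ℝ (Fin 3) | R₁ ≤ ‖y‖}.indicator G y)) volume :=
    (hGi.indicator hsm).const_mul C
  rw [UnboundedOperators.heatExtension_apply]
  calc ‖∫ y, G y • g (x - y)‖ ≤ ∫ y, ‖G y • g (x - y)‖ := norm_integral_le_integral_norm _
    _ ≤ ∫ y, (G y * (ε / 2) + C * ({y : EuclideanSpace ℝ (Fin 3) | R₁ ≤ ‖y‖}.indicator G y)) :=
        integral_mono (integrable_heatKernel_smul_of_norm_le hgm hC hτ x).norm (hint1.add hint2) hpt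
    _ = (∫ y, G y) * (ε / 2) + C * ∫ y in {y : EuclideanSpace ℝ (Fin 3) | R₁ ≤ ‖y‖}, G y := by
        rw [integral_add hint1 hint2, integral_mul_const, integral_const_mul, integral_indicator hsm]
    _ ≤ 1 * (ε / 2) + C * η := by
        have h1 : ∫ y, G y = 1 := UnboundedOperators.integral_heatKernel_eq_one_holds hτ
        have h2 : ∫ y in {y : EuclideanSpace ℝ (Fin 3) | R₁ ≤ ‖y‖}, G y ≤ η := (hR₁ R₁ le_rfl).le
        rw [h1]
        gcongr
    _ ≤ ε := by
        rw [hη, one_mul]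
        have : C * (ε / 2 / (C + 1)) = ε / 2 * (C / (C + 1)) := by ring
        rw [this]
        have hc : C / (C + 1) ≤ 1 := by rw [div_le_one (by positivity)]; linarith
        nlinarith

end HeatDecay

/-! ### Horizontal decay of the Duhamel term -/

section DuhamelDecay

/-- **Koch–Tataru's kernel bound (14) in dimension three**: `‖K(σ, z)[a, b]‖ ≤
C₀ (σ + ‖z‖²)^{-2} ‖a‖ ‖b‖` for `σ > 0` (KNSS 2009, (3.8): `|K_{ijk}(x,t)| ≤ C(|x|² + t)^{-(n+1)/2}`,
`n = 3`). [cite: KochNadirashviliSereginSverak2009, §3 (3.8) (arXiv p. 6)] -/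
theorem exists_norm_oseenKernel_three_le :
    ∃ C₀ : ℝ, 0 < C₀ ∧ ∀ ⦃σ : ℝ⦄, 0 < σ → ∀ z a b : EuclideanSpace ℝ (Fin 3),
      ‖oseenKernel σ z a b‖ ≤ C₀ * (σ + ‖z‖ ^ 2) ^ (-(2 : ℝ)) * ‖a‖ * ‖b‖ := by
  obtain ⟨C₀, hC₀, hK⟩ := exists_norm_oseenKernel_le (E := EuclideanSpace ℝ (Fin 3))
  refine ⟨C₀, hC₀, fun σ hσ z a b => ?_⟩
  have h := hK hσ z a b
  have hfin : (Module.finrank ℝ (EuclideanSpace ℝ (Fin 3)) : ℝ) = 3 := by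
    rw [finrank_euclideanSpace_fin]; norm_num
  rw [hfin, show (-((3 + 1 : ℝ) / 2)) = -(2 : ℝ) by norm_num] at h
  exact h

/-- The parabolic weight off the unit ball is dominated by a fixed integrable envelope:
`(σ + ‖z‖²)^{-2} ≤ 4 (1 + ‖z‖²)^{-2}` for `σ > 0`, `‖z‖ ≥ 1`. [folklore] -/
theorem rpow_neg_two_le_envelope {σ : ℝ} (hσ : 0 < σ) {z : EuclideanSpace ℝ (Fin 3)}
    (hz : 1 ≤ ‖z‖) :
    (σ + ‖z‖ ^ 2) ^ (-(2 : ℝ)) ≤ 4 * (1 + ‖z‖ ^ 2) ^ (-(2 : ℝ)) := by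
  have hz2 : 1 ≤ ‖z‖ ^ 2 := by nlinarith
  have h1 : (1 + ‖z‖ ^ 2) / 2 ≤ σ + ‖z‖ ^ 2 := by linarith
  have h2 : 0 < (1 + ‖z‖ ^ 2) / 2 := by positivity
  calc (σ + ‖z‖ ^ 2) ^ (-(2 : ℝ)) ≤ ((1 + ‖z‖ ^ 2) / 2) ^ (-(2 : ℝ)) :=
        Real.rpow_le_rpow_of_nonpos h2 h1 (by norm_num)
    _ = (1 + ‖z‖ ^ 2) ^ (-(2 : ℝ)) / (2 : ℝ) ^ (-(2 : ℝ)) :=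
        Real.div_rpow (by positivity) (by norm_num) _
    _ = 4 * (1 + ‖z‖ ^ 2) ^ (-(2 : ℝ)) := by
        rw [Real.rpow_neg (by norm_num : (0 : ℝ) ≤ 2), Real.rpow_two]
        ring

/-- **The Duhamel term of the near fields is small far away.** Let `v` be any fields on `(s, t)`
bounded by `M` and vanishing outside the cylinder `{|y'| < R₀}`. Then at a point `x` with
`|x'| ≥ R₀ + R₁`, `R₁ ≥ 1`, `‖B¹_s(v,v)(t)(x)‖ ≤ C₀ M² (t - s) ∫_{R₁ ≤ ‖z‖} 4(1 + ‖z‖²)^{-2} dz`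
(the kernel bound (3.8) at distance `‖x - y‖ ≥ |(x-y)'| ≥ R₁`; no measurability is needed for the
upper bound). [cite: KochNadirashviliSereginSverak2009, §3 (3.8) and proof of Thm 6.1, last paragraph (arXiv pp. 6, 12)] -/
theorem norm_oseenDuhamel_near_le {C₀ : ℝ} (hC₀ : 0 < C₀)
    (hK : ∀ ⦃σ : ℝ⦄, 0 < σ → ∀ z a b : EuclideanSpace ℝ (Fin 3),
      ‖oseenKernel σ z a b‖ ≤ C₀ * (σ + ‖z‖ ^ 2) ^ (-(2 : ℝ)) * ‖a‖ * ‖b‖)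
    {v : ℝ → EuclideanSpace ℝ (Fin 3) → EuclideanSpace ℝ (Fin 3)} {s t M R₀ R₁ : ℝ} (hst : s < t)
    (hM : 0 ≤ M) (hbd : ∀ τ ∈ Ioo s t, ∀ y, ‖v τ y‖ ≤ M)
    (hsupp : ∀ τ ∈ Ioo s t, ∀ y, R₀ ≤ cylRadius y → v τ y = 0) (hR₁ : 1 ≤ R₁)
    {x : EuclideanSpace ℝ (Fin 3)} (hx : R₀ + R₁ ≤ cylRadius x) :
    ‖oseenDuhamel 1 s v v t x‖ ≤
      C₀ * M ^ 2 * (t - s) * ∫ z in {z : EuclideanSpace ℝ (Fin 3) | R₁ ≤ ‖z‖},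
        4 * (1 + ‖z‖ ^ 2) ^ (-(2 : ℝ)) := by
  set S : Set (EuclideanSpace ℝ (Fin 3)) := {z | R₁ ≤ ‖z‖} with hS
  have hSm : MeasurableSet S := (isClosed_le continuous_const continuous_norm).measurableSet
  set H : EuclideanSpace ℝ (Fin 3) → ℝ := fun z => 4 * (1 + ‖z‖ ^ 2) ^ (-(2 : ℝ)) with hH
  have hH0 : ∀ z, 0 ≤ H z := fun z => by positivity
  have hHi : Integrable H volume := by
    have h := integrable_one_add_norm_sq_rpow_neg (E := EuclideanSpace ℝ (Fin 3)) (e := 2)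
      (by rw [finrank_euclideanSpace_fin]; norm_num)
    exact h.const_mul 4
  set T : ℝ := ∫ z in S, H z with hT
  have hT0 : 0 ≤ T := setIntegral_nonneg hSm fun z _ => hH0 z
  -- pointwise bound of the integrand by the translated envelope
  have hpt : ∀ τ ∈ Ioo s t, ∀ y,
      ‖oseenKernel (1 * (t - τ)) (x - y) (v τ y) (v τ y)‖ₑ ≤
        S.indicator (fun z => ENNReal.ofReal (C₀ * M ^ 2 * H z)) (x - y) := by
    intro τ hτ y
    by_cases hy : R₀ ≤ cylRadius y
    · rw [hsupp τ hτ y hy, oseenKernel_zero_left, enorm_zero]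
      exact zero_le
    · have hxy : R₁ ≤ ‖x - y‖ := by
        have h1 := SereginSverak2009.cylRadius_le_cylRadius_add x y
        have h2 := SereginSverak2009.cylRadius_le_norm' (x - y)
        linarith [not_le.1 hy]
      rw [indicator_of_mem (show x - y ∈ S from hxy), ← ofReal_norm]
      refine ENNReal.ofReal_le_ofReal ?_
      have hσ : 0 < 1 * (t - τ) := by rw [one_mul]; exact sub_pos.2 hτ.2
      have henv := rpow_neg_two_le_envelope hσ (hR₁.trans hxy)
      have hW0 : 0 ≤ C₀ * (4 * (1 + ‖x - y‖ ^ 2) ^ (-(2 : ℝ))) := by positivity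
      have h1 : C₀ * (1 * (t - τ) + ‖x - y‖ ^ 2) ^ (-(2 : ℝ)) ≤
          C₀ * (4 * (1 + ‖x - y‖ ^ 2) ^ (-(2 : ℝ))) := mul_le_mul_of_nonneg_left henv hC₀.le
      have h2 : C₀ * (1 * (t - τ) + ‖x - y‖ ^ 2) ^ (-(2 : ℝ)) * ‖v τ y‖ ≤
          C₀ * (4 * (1 + ‖x - y‖ ^ 2) ^ (-(2 : ℝ))) * M :=
        mul_le_mul h1 (hbd τ hτ y) (norm_nonneg _) hW0
      calc ‖oseenKernel (1 * (t - τ)) (x - y) (v τ y) (v τ y)‖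
          ≤ C₀ * (1 * (t - τ) + ‖x - y‖ ^ 2) ^ (-(2 : ℝ)) * ‖v τ y‖ * ‖v τ y‖ := hK hσ _ _ _
        _ ≤ C₀ * (4 * (1 + ‖x - y‖ ^ 2) ^ (-(2 : ℝ))) * M * M :=
            mul_le_mul h2 (hbd τ hτ y) (norm_nonneg _) (mul_nonneg hW0 hM)
        _ = C₀ * M ^ 2 * H (x - y) := by rw [hH]; ring
  -- integrate
  have hslice : ∀ τ ∈ Ioo s t,
      ∫⁻ y, ‖oseenKernel (1 * (t - τ)) (x - y) (v τ y) (v τ y)‖ₑ ≤ ENNReal.ofReal (C₀ * M ^ 2 * T) := by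
    intro τ hτ
    calc ∫⁻ y, ‖oseenKernel (1 * (t - τ)) (x - y) (v τ y) (v τ y)‖ₑ
        ≤ ∫⁻ y, S.indicator (fun z => ENNReal.ofReal (C₀ * M ^ 2 * H z)) (x - y) :=
          lintegral_mono fun y => hpt τ hτ y
      _ = ∫⁻ z, S.indicator (fun z => ENNReal.ofReal (C₀ * M ^ 2 * H z)) z :=
          lintegral_sub_left_eq_self (fun z => S.indicator (fun z => ENNReal.ofReal (C₀ * M ^ 2 * H z)) z) x
      _ = ∫⁻ z in S, ENNReal.ofReal (C₀ * M ^ 2 * H z) := lintegral_indicator hSm _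
      _ = ENNReal.ofReal (∫ z in S, C₀ * M ^ 2 * H z) := by
          rw [ofReal_integral_eq_lintegral_ofReal ((hHi.const_mul _).integrableOn)
            (Eventually.of_forall fun z => by positivity)]
      _ = ENNReal.ofReal (C₀ * M ^ 2 * T) := by rw [integral_const_mul]
  have hmain : ‖oseenDuhamel 1 s v v t x‖ₑ ≤ ENNReal.ofReal (C₀ * M ^ 2 * T * (t - s)) := by
    calc ‖oseenDuhamel 1 s v v t x‖ₑ
        ≤ ∫⁻ τ in Ioo s t, ‖∫ y, oseenKernel (1 * (t - τ)) (x - y) (v τ y) (v τ y)‖ₑ := by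
          rw [oseenDuhamel_apply]; exact enorm_integral_le_lintegral_enorm _
      _ ≤ ∫⁻ τ in Ioo s t, ∫⁻ y, ‖oseenKernel (1 * (t - τ)) (x - y) (v τ y) (v τ y)‖ₑ :=
          lintegral_mono fun τ => enorm_integral_le_lintegral_enorm _
      _ ≤ ∫⁻ τ in Ioo s t, ENNReal.ofReal (C₀ * M ^ 2 * T) := setLIntegral_mono' measurableSet_Ioo hslice
      _ = ENNReal.ofReal (C₀ * M ^ 2 * T) * volume (Ioo s t) := setLIntegral_const _ _
      _ = ENNReal.ofReal (C₀ * M ^ 2 * T * (t - s)) := by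
          rw [Real.volume_Ioo, ← ENNReal.ofReal_mul (by positivity)]
  rw [← ofReal_norm] at hmain
  have h := (ENNReal.ofReal_le_ofReal_iff (by positivity)).1 hmain
  calc ‖oseenDuhamel 1 s v v t x‖ ≤ C₀ * M ^ 2 * T * (t - s) := h
    _ = C₀ * M ^ 2 * (t - s) * T := by ring

/-- **The Duhamel term of bounded fields decaying at horizontal infinity decays at horizontal
infinity** (KNSS 2009, proof of Thm 6.1, last paragraph: "Using the decay of the kernel (3.8) …
all the terms in the decomposition … will again satisfy (6.2)", here qualitatively). Let `u` be
continuous on the open slab `(a, b) × ℝ³ ⊇ (s, t) × ℝ³`, bounded by `M` on `(s, t) × ℝ³`, with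
`sup_{τ ∈ (s,t), |y'| ≥ R} ‖u(τ, y)‖ → 0` as `R → ∞`. Then for every `ε > 0` there is `R` with
`‖B¹_s(u,u)(t)(x)‖ ≤ ε` whenever `|x'| ≥ R`: split `u = 1_{|y'| ≥ R₀}u + 1_{|y'| < R₀}u`
(`oseenDuhamel_eq_add_of_indicator_compl`); the far fields are bounded by `η`, so their Duhamel
term is `O(η²√(t-s))` everywhere ((4.4), `exists_norm_oseenDuhamel_bounded_le`); the near fields
contribute the kernel tail (`norm_oseenDuhamel_near_le`, `tendsto_setIntegral_norm_ge_atTop`). [cite: KochNadirashviliSereginSverak2009, proof of Thm 6.1, last paragraph (arXiv p. 12)] -/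
theorem exists_forall_norm_oseenDuhamel_le_of_cylRadius
    {u : ℝ → EuclideanSpace ℝ (Fin 3) → EuclideanSpace ℝ (Fin 3)} {a b s t M : ℝ}
    (hu : ContinuousOn (uncurry u) (Ioo a b ×ˢ univ)) (has : a ≤ s) (htb : t ≤ b) (hst : s < t)
    (hM : 0 ≤ M) (hbd : ∀ τ ∈ Ioo s t, ∀ y, ‖u τ y‖ ≤ M)
    (hdec : ∀ ε > 0, ∃ R : ℝ, ∀ τ ∈ Ioo s t, ∀ y, R ≤ cylRadius y → ‖u τ y‖ ≤ ε)
    {ε : ℝ} (hε : 0 < ε) :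
    ∃ R : ℝ, ∀ x, R ≤ cylRadius x → ‖oseenDuhamel 1 s u u t x‖ ≤ ε := by
  obtain ⟨Cs, hCs, hsup⟩ := exists_norm_oseenDuhamel_bounded_le (E := EuclideanSpace ℝ (Fin 3))
  obtain ⟨C₀, hC₀, hK⟩ := exists_norm_oseenKernel_three_le
  -- the far threshold
  set A : ℝ := Cs * (1 : ℝ) ^ (-(1 / 2 : ℝ)) * (2 * Real.sqrt (t - s)) with hA
  have hA0 : 0 ≤ A := by positivity
  set η : ℝ := min 1 (ε / 2 / (A + 1)) with hη
  have hη0 : 0 < η := lt_min one_pos (by positivity)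
  have hη1 : η ≤ 1 := min_le_left _ _
  have hAη : A * η ^ 2 ≤ ε / 2 := by
    have h1 : η ^ 2 ≤ η := by nlinarith
    calc A * η ^ 2 ≤ A * η := mul_le_mul_of_nonneg_left h1 hA0
      _ ≤ A * (ε / 2 / (A + 1)) := mul_le_mul_of_nonneg_left (min_le_right _ _) hA0
      _ = ε / 2 * (A / (A + 1)) := by ring
      _ ≤ ε / 2 * 1 := by
          gcongr
          rw [div_le_one (by positivity)]; linarith
      _ = ε / 2 := mul_one _
  obtain ⟨R₀, hR₀⟩ := hdec η hη0
  -- the near threshold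
  set H : EuclideanSpace ℝ (Fin 3) → ℝ := fun z => 4 * (1 + ‖z‖ ^ 2) ^ (-(2 : ℝ)) with hH
  have hHi : Integrable H volume := by
    have h := integrable_one_add_norm_sq_rpow_neg (E := EuclideanSpace ℝ (Fin 3)) (e := 2)
      (by rw [finrank_euclideanSpace_fin]; norm_num)
    exact h.const_mul 4
  have htail := tendsto_setIntegral_norm_ge_atTop hHi
  set θ : ℝ := ε / 2 / (C₀ * M ^ 2 * (t - s) + 1) with hθ
  have hθ0 : 0 < θ := by
    have : 0 < C₀ * M ^ 2 * (t - s) + 1 := by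
      have := sub_pos.2 hst; positivity
    positivity
  obtain ⟨R₁, hR₁⟩ := ((htail.eventually (gt_mem_nhds hθ0)).and (eventually_ge_atTop 1)).exists_forall_of_atTop
  refine ⟨R₀ + R₁, fun x hx => ?_⟩
  -- split along the cylinder `{R₀ ≤ |y'|}`
  set O : Set (EuclideanSpace ℝ (Fin 3)) := {y | R₀ ≤ cylRadius y} with hO
  have hOm : MeasurableSet O := (isClosed_le continuous_const continuous_cylRadius).measurableSet
  have hsplit := oseenDuhamel_eq_add_of_indicator_compl one_pos hu has htb hst hM hbd hOm x
  -- the far part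
  have hfar : ‖oseenDuhamel 1 s (fun τ y => O.indicator (u τ) y) (fun τ y => O.indicator (u τ) y) t x‖ ≤
      ε / 2 := by
    have hb : ∀ τ ∈ Ioo s t, ∀ y, ‖O.indicator (u τ) y‖ ≤ η := by
      intro τ hτ y
      by_cases hy : y ∈ O
      · rw [indicator_of_mem hy]; exact hR₀ τ hτ y hy
      · rw [indicator_of_notMem hy, norm_zero]; exact hη0.le
    have h := hsup one_pos hst hη0.le hb hb x
    calc _ ≤ Cs * η ^ 2 * (1 : ℝ) ^ (-(1 / 2 : ℝ)) * (2 * Real.sqrt (t - s)) := h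
      _ = A * η ^ 2 := by rw [hA]; ring
      _ ≤ ε / 2 := hAη
  -- the near part
  have hnear : ‖oseenDuhamel 1 s (fun τ y => Oᶜ.indicator (u τ) y) (fun τ y => Oᶜ.indicator (u τ) y) t x‖ ≤
      ε / 2 := by
    have hb : ∀ τ ∈ Ioo s t, ∀ y, ‖Oᶜ.indicator (u τ) y‖ ≤ M := by
      intro τ hτ y
      by_cases hy : y ∈ Oᶜ
      · rw [indicator_of_mem hy]; exact hbd τ hτ y
      · rw [indicator_of_notMem hy, norm_zero]; exact hM
    have hsupp : ∀ τ ∈ Ioo s t, ∀ y, R₀ ≤ cylRadius y → Oᶜ.indicator (u τ) y = 0 := by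
      intro τ _ y hy
      have hyO : y ∉ Oᶜ := fun h => h hy
      exact indicator_of_notMem hyO _
    have h := norm_oseenDuhamel_near_le hC₀ hK hst hM hb hsupp (hR₁ R₁ le_rfl).2 hx
    have hT : ∫ z in {z : EuclideanSpace ℝ (Fin 3) | R₁ ≤ ‖z‖}, 4 * (1 + ‖z‖ ^ 2) ^ (-(2 : ℝ)) < θ :=
      (hR₁ R₁ le_rfl).1
    have hT0 : 0 ≤ ∫ z in {z : EuclideanSpace ℝ (Fin 3) | R₁ ≤ ‖z‖}, 4 * (1 + ‖z‖ ^ 2) ^ (-(2 : ℝ)) :=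
      setIntegral_nonneg (isClosed_le continuous_const continuous_norm).measurableSet
        fun z _ => by positivity
    have hc0 : 0 ≤ C₀ * M ^ 2 * (t - s) := by have := sub_pos.2 hst; positivity
    calc _ ≤ C₀ * M ^ 2 * (t - s) * ∫ z in {z : EuclideanSpace ℝ (Fin 3) | R₁ ≤ ‖z‖},
          4 * (1 + ‖z‖ ^ 2) ^ (-(2 : ℝ)) := h
      _ ≤ C₀ * M ^ 2 * (t - s) * θ := mul_le_mul_of_nonneg_left hT.le hc0
      _ = ε / 2 * (C₀ * M ^ 2 * (t - s) / (C₀ * M ^ 2 * (t - s) + 1)) := by rw [hθ]; ring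
      _ ≤ ε / 2 * 1 := by
          gcongr
          rw [div_le_one (by linarith)]; linarith
      _ = ε / 2 := mul_one _
  rw [hsplit]
  calc _ ≤ ‖oseenDuhamel 1 s (fun τ y => O.indicator (u τ) y) (fun τ y => O.indicator (u τ) y) t x‖ +
        ‖oseenDuhamel 1 s (fun τ y => Oᶜ.indicator (u τ) y) (fun τ y => Oᶜ.indicator (u τ) y) t x‖ :=
        norm_add_le _ _
    _ ≤ ε / 2 + ε / 2 := add_le_add hfar hnear
    _ = ε := by ring

end DuhamelDecay

/-! ### Continuity in the initial time -/

section InitialTime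

/-- **Continuity of the caloric term in the initial time**: for `u` continuous and bounded on the
open slab `(a, b) × ℝ³` and `a < r₀ < b`, `r₀ < t`, the map `r ↦ e^{(t-r)Δ}u(r)(x)` is continuous
at `r₀` (dominated convergence: near `r₀` the kernels `G_{t-r}` lie under a fixed Gaussian,
`heatKernel_le_mul_heatKernel_of_norm_sub_le`, and `(r, z) ↦ G_{t-r}(z) u(r, x - z)` is
continuous in `r`). [folklore] -/
theorem continuousAt_heatExtension_datum
    {u : ℝ → EuclideanSpace ℝ (Fin 3) → EuclideanSpace ℝ (Fin 3)} {a b L : ℝ}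
    (hu : ContinuousOn (uncurry u) (Ioo a b ×ˢ univ)) (hbd : ∀ r ∈ Ioo a b, ∀ y, ‖u r y‖ ≤ L)
    {t r₀ : ℝ} (har : a < r₀) (hrb : r₀ < b) (hrt : r₀ < t) (x : EuclideanSpace ℝ (Fin 3)) :
    ContinuousAt (fun r => UnboundedOperators.heatExtension (u r) (t - r) x) r₀ := by
  -- a neighbourhood of `r₀` on which `t - r ∈ [σ₁, σ₂]`, `σ₁ > 0`
  set σ₁ : ℝ := (t - r₀) / 2 with hσ₁
  set σ₂ : ℝ := 3 * (t - r₀) / 2 with hσ₂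
  have hσ₁0 : 0 < σ₁ := by rw [hσ₁]; linarith
  set N : Set ℝ := Ioo (max a (r₀ - (t - r₀) / 2)) (min b ((r₀ + t) / 2)) with hN
  have hr₀N : r₀ ∈ N := by
    refine ⟨max_lt har (by linarith), lt_min hrb (by linarith)⟩
  have hNnhds : N ∈ 𝓝 r₀ := isOpen_Ioo.mem_nhds hr₀N
  have hNab : ∀ r ∈ N, r ∈ Ioo a b := fun r hr =>
    ⟨(le_max_left _ _).trans_lt hr.1, hr.2.trans_le (min_le_left _ _)⟩
  have hNσ : ∀ r ∈ N, σ₁ ≤ t - r ∧ t - r ≤ σ₂ := by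
    intro r hr
    have h1 : r₀ - (t - r₀) / 2 < r := (le_max_right _ _).trans_lt hr.1
    have h2 : r < (r₀ + t) / 2 := hr.2.trans_le (min_le_right _ _)
    constructor <;> [rw [hσ₁]; rw [hσ₂]] <;> linarith
  -- slices are continuous
  have hslice : ∀ r ∈ Ioo a b, Continuous fun z => u r (x - z) := fun r hr =>
    hu.comp_continuous (continuous_const.prodMk (continuous_const.sub continuous_id))
      fun z => ⟨hr, mem_univ _⟩
  simp_rw [UnboundedOperators.heatExtension_apply]
  -- the dominating Gaussian
  set Kc : ℝ := (4 * Real.pi * σ₁) ^ (-(Module.finrank ℝ (EuclideanSpace ℝ (Fin 3)) : ℝ) / 2) *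
    Real.exp ((0 : ℝ) ^ 2 / (4 * σ₁)) *
    (4 * Real.pi * (2 * σ₂)) ^ ((Module.finrank ℝ (EuclideanSpace ℝ (Fin 3)) : ℝ) / 2) with hKc
  have hL0 : 0 ≤ L := (norm_nonneg _).trans (hbd r₀ ⟨har, hrb⟩ 0)
  refine continuousAt_of_dominated (bound := fun z => Kc * UnboundedOperators.heatKernel (2 * σ₂) z * L)
    ?_ ?_ ?_ ?_
  · filter_upwards [hNnhds] with r hr
    exact ((UnboundedOperators.continuous_heatKernel _).smul (hslice r (hNab r hr))).aestronglyMeasurable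
  · filter_upwards [hNnhds] with r hr
    refine Eventually.of_forall fun z => ?_
    have hG := heatKernel_le_mul_heatKernel_of_norm_sub_le (E := EuclideanSpace ℝ (Fin 3)) hσ₁0
      (hNσ r hr).1 (hNσ r hr).2 (x := z) (y := z) (R := 0) (by simp)
    rw [norm_smul, Real.norm_of_nonneg (UnboundedOperators.heatKernel_pos (hσ₁0.trans_le (hNσ r hr).1) z).le]
    calc UnboundedOperators.heatKernel (t - r) z * ‖u r (x - z)‖
        ≤ (Kc * UnboundedOperators.heatKernel (2 * σ₂) z) * L :=
          mul_le_mul hG (hbd r (hNab r hr) _) (norm_nonneg _)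
            (mul_nonneg (by positivity) (UnboundedOperators.heatKernel_pos (by positivity) z).le)
      _ = Kc * UnboundedOperators.heatKernel (2 * σ₂) z * L := by ring
  · exact ((UnboundedOperators.integrable_heatKernel_holds (by positivity)).const_mul Kc).mul_const L
  · refine Eventually.of_forall fun z => ?_
    have h1 : ContinuousAt (fun r => UnboundedOperators.heatKernel (t - r) z) r₀ := by
      have hc := (continuousOn_heatKernel_time (E := EuclideanSpace ℝ (Fin 3)) z).continuousAt
        (Ioi_mem_nhds (show (0 : ℝ) < t - r₀ by linarith))
      exact hc.comp (continuous_const.sub continuous_id).continuousAt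
    have h2 : ContinuousAt (fun r => u r (x - z)) r₀ := by
      have hc : ContinuousAt (uncurry u) (r₀, x - z) :=
        hu.continuousAt ((isOpen_Ioo.prod isOpen_univ).mem_nhds ⟨⟨har, hrb⟩, mem_univ _⟩)
      have hg : ContinuousAt (fun r : ℝ => (r, x - z)) r₀ :=
        (continuous_id.prodMk continuous_const).continuousAt
      exact ContinuousAt.comp (g := uncurry u) (f := fun r : ℝ => (r, x - z)) hc hg
    exact h1.smul h2

/-- **Continuity of the Duhamel term in the initial time**: for `u` continuous and bounded by `L`
on the open slab `(a, b) × ℝ³` and `a < r₀ < t ≤ b`, the map `r ↦ B¹_r(u,u)(t)(x)` is continuous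
at `r₀` (it is `∫_r^t f` for the marginal `f(τ) = ∫ K(t-τ, x-y)[u,u] dy`, integrable on
`(r₁, t)`, `a < r₁ < r₀`). [folklore] -/
theorem continuousAt_oseenDuhamel_initialTime
    {u : ℝ → EuclideanSpace ℝ (Fin 3) → EuclideanSpace ℝ (Fin 3)} {a b L : ℝ}
    (hu : ContinuousOn (uncurry u) (Ioo a b ×ˢ univ)) (hL : 0 ≤ L)
    (hbd : ∀ r ∈ Ioo a b, ∀ y, ‖u r y‖ ≤ L) {t r₀ : ℝ} (har : a < r₀) (hrt : r₀ < t) (htb : t ≤ b)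
    (x : EuclideanSpace ℝ (Fin 3)) :
    ContinuousAt (fun r => oseenDuhamel 1 r u u t x) r₀ := by
  set r₁ : ℝ := (a + r₀) / 2 with hr₁
  have har₁ : a < r₁ := by rw [hr₁]; linarith
  have hr₁r₀ : r₁ < r₀ := by rw [hr₁]; linarith
  have hr₁t : r₁ < t := hr₁r₀.trans hrt
  set f : ℝ → EuclideanSpace ℝ (Fin 3) := fun τ =>
    ∫ y, oseenKernel (1 * (t - τ)) (x - y) (u τ y) (u τ y) with hf
  -- integrability of the marginal on `(r₁, t)`
  have hum : AEStronglyMeasurable (uncurry u)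
      ((volume : Measure (ℝ × EuclideanSpace ℝ (Fin 3))).restrict (Ioo r₁ t ×ˢ univ)) :=
    (hu.mono (prod_mono (Ioo_subset_Ioo har₁.le htb) subset_rfl)).aestronglyMeasurable
      (measurableSet_Ioo.prod MeasurableSet.univ)
  have hbd' : ∀ τ ∈ Ioo r₁ t, ∀ y, ‖u τ y‖ ≤ L := fun τ hτ y =>
    hbd τ ⟨har₁.trans hτ.1, hτ.2.trans_le htb⟩ y
  have hint := integrable_oseenKernel_duhamel_bounded one_pos hum hum hL hbd' hbd' hr₁t le_rfl x
  rw [volume_restrict_prod_univ_eq_prod] at hint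
  have hfi : IntegrableOn f (Ioo r₁ t) := hint.integral_prod_left
  have hfii : IntervalIntegrable f volume r₁ t := by
    rw [intervalIntegrable_iff_integrableOn_Ioo_of_le hr₁t.le]
    exact hfi
  -- the Duhamel term as a primitive
  have heq : ∀ r ∈ Ioo r₁ t, oseenDuhamel 1 r u u t x = -∫ τ in t..r, f τ := by
    intro r hr
    rw [oseenDuhamel_apply, intervalIntegral.integral_symm, neg_neg,
      intervalIntegral.integral_of_le hr.2.le, integral_Ioc_eq_integral_Ioo]
  have hprim : ContinuousOn (fun r => ∫ τ in t..r, f τ) (uIcc r₁ t) :=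
    intervalIntegral.continuousOn_primitive_interval' hfii (right_mem_uIcc)
  have hr₀mem : Ioo r₁ t ∈ 𝓝 r₀ := isOpen_Ioo.mem_nhds ⟨hr₁r₀, hrt⟩
  have hcont : ContinuousAt (fun r => -∫ τ in t..r, f τ) r₀ := by
    refine (hprim.continuousAt ?_).neg
    rw [uIcc_of_le hr₁t.le]
    exact Icc_mem_nhds hr₁r₀ hrt
  refine hcont.congr ?_
  filter_upwards [hr₀mem] with r hr
  exact (heq r hr).symm

end InitialTime

end Literature.Analysis.FluidPDE

end
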